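import Literature.NumberTheory.Sieve.SmoothZetaDecayChebyshev
import Literature.NumberTheory.Sieve.BrunTitchmarshShortInterval
import HarnessLib

/-!
# Decay of `ζ(s, y)` for `3 ≤ |t| ≤ κ √y`: Brun–Titchmarsh on the bad primes

(Module docstring completed once the file is stable.)
-/

noncomputable section

open Real Finset Chebyshev

namespace Literature.NumberTheory.Sieve

/-! ### Auxiliary inequalities -/

/-- Sums of a non-negative function over a `Finset.biUnion` are at most the iterated sums. [folklore] -/
private theorem sum_biUnion_le_sum' {ι κ : Type*} [DecidableEq κ] (s : Finset ι) (t : ι → Finset κ)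
    {f : κ → ℝ} (hf : ∀ x, 0 ≤ f x) :
    ∑ x ∈ s.biUnion t, f x ≤ ∑ i ∈ s, ∑ x ∈ t i, f x := by
  classical
  induction s using Finset.induction_on with
  | empty => simp
  | insert a s ha ih =>
    rw [Finset.biUnion_insert, Finset.sum_insert ha]
    have hu := Finset.sum_union_inter (s₁ := t a) (s₂ := s.biUnion t) (f := f)
    have hi : 0 ≤ ∑ x ∈ t a ∩ s.biUnion t, f x := Finset.sum_nonneg fun x _ ↦ hf x
    linarith

/-- `e^r - e^{-r} ≤ (21/10) r` and `e^r - e^{-r} ≥ (19/10) r` for `0 ≤ r ≤ 1/20`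
(`|e^x - 1 - x| ≤ x²` for `|x| ≤ 1`). [folklore] -/
theorem exp_sub_exp_neg_bounds {r : ℝ} (hr0 : 0 ≤ r) (hr : r ≤ 1 / 20) :
    19 / 10 * r ≤ Real.exp r - Real.exp (-r) ∧ Real.exp r - Real.exp (-r) ≤ 21 / 10 * r := by
  have h1 := Real.abs_exp_sub_one_sub_id_le (x := r) (by rw [abs_of_nonneg hr0]; linarith)
  have h2 := Real.abs_exp_sub_one_sub_id_le (x := -r) (by rw [abs_neg, abs_of_nonneg hr0]; linarith)
  rw [abs_le] at h1 h2
  have hr2 : r ^ 2 ≤ r / 20 := by nlinarith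
  constructor
  · nlinarith [h1.1, h2.2]
  · nlinarith [h1.2, h2.1]

/-- `e³ > 20`, so `log 4 · e^{-3} < 0.07`. [folklore] -/
theorem exp_three_gt : (20 : ℝ) < Real.exp 3 := by
  have h := Real.exp_one_gt_d9
  have h0 : (0 : ℝ) ≤ 2.7182818283 := by norm_num
  have h1 : (2.7182818283 : ℝ) ^ 3 < Real.exp 1 ^ 3 := pow_lt_pow_left₀ h h0 (by norm_num)
  have h2 : Real.exp 1 ^ 3 = Real.exp 3 := by rw [Real.exp_one_pow]; norm_num
  rw [h2] at h1
  have h3 : (20 : ℝ) < (2.7182818283 : ℝ) ^ 3 := by norm_num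
  linarith

/-! ### The decay sum for `3 ≤ |t| ≤ κ √y` -/

set_option maxHeartbeats 1600000 in
/-- **Decay of `ζ(s, y)` in the range `3 ≤ |t| ≤ κ √y`**: there are `c, κ > 0` and `y₀` with
`Σ_{p ≤ y} p^{-σ}(1 - cos(t log p)) ≥ c · y^{1-σ}/log y` for all `y ≥ y₀`, `3/5 ≤ σ ≤ 1`,
`3 ≤ |t| ≤ κ √y`. Proof: the primes `y/e³ < p ≤ y` have `θ`-mass `≥ 0.27 y` (Chebyshev); the bad ones
(`t log p` within `ε'` of `2πℤ`) lie in `≤ 3|t|/2` intervals `(e^{kP - r}, e^{kP + r})`, `P = 2π/|t|`,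
`r = ε'/|t|`, each of length `≍ r e^{kP} ≥ √y/10` and carrying, by the Brun–Titchmarsh inequality of the
tree (`sum_log_primes_Ioc_le`), `θ`-mass `≪ C r y + C`; so the bad mass is `≤ 80 C ε' y + 9 C |t|
≤ 0.1 y` for `ε' = 1/(2000 (C+1))`, and the good primes give `Σ p^{-σ}(1 - cos) ≥ (1 - cos ε') · 0.17 ·
y^{1-σ}/log y`. [cite: HildebrandTenenbaum1986, §3 Lemma 8 (iii)] -/
theorem exists_decaySum_ge_linear :
    ∃ c : ℝ, 0 < c ∧ ∃ κ : ℝ, 0 < κ ∧ ∃ y₀ : ℕ, ∀ y : ℕ, y₀ ≤ y → ∀ σ : ℝ, 3 / 5 ≤ σ → σ ≤ 1 →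
      ∀ t : ℝ, 3 ≤ |t| → |t| ≤ κ * (y : ℝ) ^ (1 / 2 : ℝ) →
        c * ((y : ℝ) ^ (1 - σ) / Real.log y) ≤
          ∑ p ∈ Nat.primesLE y, (p : ℝ) ^ (-σ) * (1 - Real.cos (t * Real.log p)) := by
  classical
  obtain ⟨C, hC, hBT⟩ := sum_log_primes_Ioc_le
  obtain ⟨c₁, hc₁, hθ⟩ := exists_theta_ge_linear
  -- constants
  set ε' : ℝ := 1 / (2000 * (C + 1)) with hε'
  have hε'0 : 0 < ε' := by positivity
  have hε'20 : ε' ≤ 1 / 20 := by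
    rw [hε', div_le_div_iff₀ (by positivity) (by norm_num)]; linarith
  have hCε' : C * ε' ≤ 1 / 2000 := by
    rw [hε', mul_one_div, div_le_div_iff₀ (by positivity) (by norm_num)]; linarith
  set δ : ℝ := 1 - Real.cos ε' with hδ
  have hδ0 : 0 < δ := by
    have h := two_div_pi_sq_mul_sq_le_one_sub_cos (φ := ε')
      (by rw [abs_of_nonneg hε'0.le]; linarith [Real.pi_gt_d2])
    have : 0 < 2 / Real.pi ^ 2 * ε' ^ 2 := by positivity
    linarith
  set κ : ℝ := ε' / 12 with hκ
  have hκ0 : 0 < κ := by positivity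
  -- thresholds: `log y ≥ 30`, `y ≥ 140 c₁`, `√y ≥ 1000 (C+1)` (so that `9 C κ √y ≤ 0.01 y` etc.)
  set Y : ℝ := max (Real.exp 30) (max (140 * c₁) ((1000 * (C + 1)) ^ 2)) with hY
  refine ⟨17 / 100 * δ, by positivity, κ, hκ0, ⌈Y⌉₊, fun y hy σ hσ35 hσ1 t ht3 htκ => ?_⟩
  have hyY : Y ≤ y := le_trans (Nat.le_ceil Y) (by exact_mod_cast hy)
  have hy30 : Real.exp 30 ≤ y := le_trans (le_max_left _ _) hyY
  have hyc₁ : 140 * c₁ ≤ y := le_trans (le_trans (le_max_left _ _) (le_max_right _ _)) hyY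
  have hyC : (1000 * (C + 1)) ^ 2 ≤ y := le_trans (le_trans (le_max_right _ _) (le_max_right _ _)) hyY
  have hy0 : (0 : ℝ) < y := lt_of_lt_of_le (Real.exp_pos _) hy30
  have hy1 : (1 : ℝ) < y := lt_of_lt_of_le (by have := Real.add_one_le_exp (30 : ℝ); linarith) hy30
  set L : ℝ := Real.log y with hL
  have hL30 : 30 ≤ L := by
    have := Real.log_le_log (Real.exp_pos _) hy30; rwa [Real.log_exp] at this
  have hL0 : 0 < L := by linarith
  have hsqrt0 : 0 < (y : ℝ) ^ (1 / 2 : ℝ) := Real.rpow_pos_of_pos hy0 _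
  have hsqrt_sq : (y : ℝ) ^ (1 / 2 : ℝ) * (y : ℝ) ^ (1 / 2 : ℝ) = y := by
    rw [← Real.rpow_add hy0]; norm_num
  have hsqrtC : 1000 * (C + 1) ≤ (y : ℝ) ^ (1 / 2 : ℝ) := by
    have h2 := Real.rpow_le_rpow (by positivity) hyC (by norm_num : (0 : ℝ) ≤ 1 / 2)
    rwa [← Real.rpow_natCast, ← Real.rpow_mul (by positivity), show ((2 : ℕ) : ℝ) * (1 / 2) = 1 by
      norm_num, Real.rpow_one] at h2
  -- reduce to `t > 0`
  wlog htpos : 0 < t generalizing t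
  · have ht0 : t ≤ 0 := le_of_not_gt htpos
    have htne : t ≠ 0 := by intro h; rw [h, abs_zero] at ht3; linarith
    have h := this (-t) (by rwa [abs_neg]) (by rwa [abs_neg]) (by
      rcases lt_or_eq_of_le ht0 with h | h
      · linarith
      · exact absurd h htne)
    simpa [neg_mul, Real.cos_neg] using h
  rw [abs_of_pos htpos] at ht3 htκ
  have hπ := Real.pi_gt_d2
  have hπ' := Real.pi_lt_d2
  -- `t ≤ κ √y ≤ y^{1/2}/12000`-type bounds
  have htsqrt : t * 12 ≤ ε' * (y : ℝ) ^ (1 / 2 : ℝ) := by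
    rw [hκ] at htκ; linarith
  set P : ℝ := 2 * Real.pi / t with hP
  set r : ℝ := ε' / t with hr
  have hP0 : 0 < P := by positivity
  have hP21 : P ≤ 21 / 10 := by rw [hP, div_le_iff₀ htpos]; linarith
  have hr0 : 0 < r := by positivity
  have hr20 : r ≤ 1 / 20 := by
    rw [hr, div_le_iff₀ htpos]; linarith
  have hrt : r * t = ε' := by rw [hr]; field_simp
  -- the window of primes `y/e³ < p ≤ y`
  set a₀ : ℝ := y * Real.exp (-3) with ha₀
  have ha₀0 : 0 < a₀ := by positivity
  have ha₀y : a₀ ≤ y := by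
    have : Real.exp (-3) ≤ 1 := Real.exp_le_one_iff.2 (by norm_num)
    exact mul_le_of_le_one_right hy0.le this
  set Q : Finset ℕ := Nat.primesLE y \ Nat.primesLE ⌊a₀⌋₊ with hQ
  have hQsub : Q ⊆ Nat.primesLE y := Finset.sdiff_subset
  have hmemQ : ∀ p ∈ Q, p.Prime ∧ a₀ < p ∧ (p : ℝ) ≤ y := by
    intro p hp
    obtain ⟨hpy, hpa⟩ := Finset.mem_sdiff.1 hp
    obtain ⟨hple, hpp⟩ := Nat.mem_primesLE.1 hpy
    refine ⟨hpp, ?_, by exact_mod_cast hple⟩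
    have hnot : ¬ p ≤ ⌊a₀⌋₊ := fun h => hpa (Nat.mem_primesLE.2 ⟨h, hpp⟩)
    push Not at hnot
    exact lt_of_lt_of_le (Nat.lt_floor_add_one a₀) (by exact_mod_cast hnot)
  -- total mass `Σ_{p ∈ Q} log p = θ(y) - θ(a₀) ≥ 0.27 y`
  have hQmass : ∑ p ∈ Q, Real.log p = θ y - θ a₀ := by
    rw [hQ, theta_sub_theta_eq_sum_sdiff ha₀y, Nat.floor_natCast]
  have htotal : 27 / 100 * (y : ℝ) ≤ ∑ p ∈ Q, Real.log p := by
    rw [hQmass]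
    have h1 := hθ y hy0.le
    have h2 := theta_le_log4_mul_x ha₀0.le
    have hl2 := Real.log_two_gt_d9
    have hl4 : Real.log 4 ≤ 1.3863 := by
      have h : Real.log 4 = 2 * Real.log 2 := by
        rw [show (4 : ℝ) = 2 ^ 2 by norm_num, Real.log_pow]; push_cast; ring
      rw [h]; have := Real.log_two_lt_d9; linarith
    have he3 : Real.exp (-3) ≤ 1 / 20 := by
      rw [Real.exp_neg, inv_le_comm₀ (Real.exp_pos 3) (by norm_num)]
      linarith [exp_three_gt]
    have h3 : θ a₀ ≤ 1.3863 * (y * (1 / 20)) := by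
      calc θ a₀ ≤ Real.log 4 * a₀ := h2
        _ ≤ 1.3863 * (y * (1 / 20)) := by
            rw [ha₀]
            exact mul_le_mul hl4 (mul_le_mul_of_nonneg_left he3 hy0.le) (by positivity)
              (by norm_num)
    have h4 : 0.3465 * (y : ℝ) ≤ Real.log 2 / 2 * y :=
      mul_le_mul_of_nonneg_right (by linarith) hy0.le
    linarith
  -- good and bad primes
  set Bad : Finset ℕ := Q.filter (fun p => ∃ k : ℤ, |t * Real.log p - k * (2 * Real.pi)| < ε')
    with hBad
  set Good : Finset ℕ := Q.filter (fun p => ¬ ∃ k : ℤ, |t * Real.log p - k * (2 * Real.pi)| < ε')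
    with hGood
  have hsplit : ∑ p ∈ Q, Real.log p = ∑ p ∈ Good, Real.log p + ∑ p ∈ Bad, Real.log p := by
    rw [hGood, hBad, add_comm, Finset.sum_filter_add_sum_filter_not]
  -- ### the bad mass is at most `y/10`
  have hbad : ∑ p ∈ Bad, Real.log p ≤ (y : ℝ) / 10 := by
    -- the intervals indexed by `k ∈ [k_lo, k_hi]`
    set klo : ℤ := ⌊(L - 3 - r) / P⌋ with hklo
    set khi : ℤ := ⌈(L + r) / P⌉ with hkhi
    set Kset : Finset ℤ := Finset.Icc klo khi with hKset
    set N : ℤ → ℕ := fun k => ⌊Real.exp (k * P - r)⌋₊ with hN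
    set M : ℤ → ℕ := fun k => ⌈Real.exp (k * P + r)⌉₊ - ⌊Real.exp (k * P - r)⌋₊ with hM
    set S : ℤ → Finset ℕ := fun k => (Ioc (N k) (N k + M k)).filter Nat.Prime with hS
    -- (1) every bad prime lies in some `S k`, `k ∈ Kset`
    have hcover : Bad ⊆ Kset.biUnion S := by
      intro p hp
      rw [hBad, Finset.mem_filter] at hp
      obtain ⟨hpQ, k, hk⟩ := hp
      obtain ⟨hpp, hpa, hpy⟩ := hmemQ p hpQ
      have hp0 : (0 : ℝ) < p := by exact_mod_cast hpp.pos
      -- `|log p - kP| < r`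
      have hdist : |Real.log p - k * P| < r := by
        have heq : t * Real.log p - k * (2 * Real.pi) = t * (Real.log p - k * P) := by
          rw [hP]; field_simp
        rw [heq, abs_mul, abs_of_pos htpos] at hk
        rw [hr, lt_div_iff₀ htpos]
        linarith
      rw [abs_lt] at hdist
      have hlow : Real.exp (k * P - r) < p := by
        calc Real.exp (k * P - r) < Real.exp (Real.log p) := Real.exp_lt_exp.2 (by linarith)
          _ = p := Real.exp_log hp0
      have hupp : (p : ℝ) < Real.exp (k * P + r) := by
        calc (p : ℝ) = Real.exp (Real.log p) := (Real.exp_log hp0).symm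
          _ < Real.exp (k * P + r) := Real.exp_lt_exp.2 (by linarith)
      have hlogp_lo : L - 3 < Real.log p := by
        have := Real.log_lt_log ha₀0 hpa
        rw [ha₀, Real.log_mul hy0.ne' (Real.exp_pos _).ne', Real.log_exp] at this
        rw [hL]; linarith
      have hlogp_hi : Real.log p ≤ L := Real.log_le_log hp0 hpy
      rw [Finset.mem_biUnion]
      refine ⟨k, ?_, ?_⟩
      · -- `k ∈ [klo, khi]`
        rw [hKset, Finset.mem_Icc, hklo, hkhi]
        constructor
        · have h1 : (L - 3 - r) / P < k := by
            rw [div_lt_iff₀ hP0]; linarith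
          have h2 : (⌊(L - 3 - r) / P⌋ : ℝ) ≤ (L - 3 - r) / P := Int.floor_le _
          exact_mod_cast (h2.trans_lt h1).le
        · have h1 : (k : ℝ) < (L + r) / P := by
            rw [lt_div_iff₀ hP0]; linarith
          have h2 : (L + r) / P ≤ ⌈(L + r) / P⌉ := Int.le_ceil _
          exact_mod_cast (h1.trans_le h2).le
      · -- `p ∈ S k`
        rw [hS, Finset.mem_filter, Finset.mem_Ioc]
        refine ⟨⟨?_, ?_⟩, hpp⟩
        · -- `N k < p`
          have : (⌊Real.exp (k * P - r)⌋₊ : ℝ) ≤ Real.exp (k * P - r) := Nat.floor_le (Real.exp_pos _).le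
          exact_mod_cast (this.trans_lt hlow)
        · -- `p ≤ N k + M k = ⌈e^{kP+r}⌉`
          have hNM : N k + M k = ⌈Real.exp (k * P + r)⌉₊ := by
            simp only [hN, hM]
            have : ⌊Real.exp (k * P - r)⌋₊ ≤ ⌈Real.exp (k * P + r)⌉₊ := by
              have h1 : (⌊Real.exp (k * P - r)⌋₊ : ℝ) ≤ Real.exp (k * P - r) :=
                Nat.floor_le (Real.exp_pos _).le
              have h2 : Real.exp (k * P - r) ≤ Real.exp (k * P + r) := Real.exp_le_exp.2 (by linarith)
              have h3 : Real.exp (k * P + r) ≤ ⌈Real.exp (k * P + r)⌉₊ := Nat.le_ceil _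
              exact_mod_cast (h1.trans (h2.trans h3))
            omega
          rw [hNM]
          exact_mod_cast (hupp.le.trans (Nat.le_ceil _))
    -- (2) the Brun–Titchmarsh bound on each `S k`, `k ∈ Kset`
    have hper : ∀ k ∈ Kset, ∑ p ∈ S k, Real.log p ≤ 76 * C * ε' * y / t + 6 * C := by
      intro k hk
      rw [hKset, Finset.mem_Icc, hklo, hkhi] at hk
      set E : ℝ := Real.exp (k * P) with hE
      have hE0 : 0 < E := Real.exp_pos _
      -- `y e^{-5.2} ≤ E ≤ 9.1 y`
      have hkP_lo : L - 3 - r - P ≤ k * P := by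
        have h1 : ((⌊(L - 3 - r) / P⌋ : ℤ) : ℝ) ≤ k := by exact_mod_cast hk.1
        have h2 : (L - 3 - r) / P - 1 < ⌊(L - 3 - r) / P⌋ := by
          have := Int.lt_floor_add_one ((L - 3 - r) / P); linarith
        have h3 : (L - 3 - r) / P - 1 ≤ k := by linarith
        have := mul_le_mul_of_nonneg_right h3 hP0.le
        rwa [sub_mul, div_mul_cancel₀ _ hP0.ne', one_mul] at this
      have hkP_hi : k * P ≤ L + r + P := by
        have h1 : (k : ℝ) ≤ ((⌈(L + r) / P⌉ : ℤ) : ℝ) := by exact_mod_cast hk.2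
        have h2 : ((⌈(L + r) / P⌉ : ℤ) : ℝ) < (L + r) / P + 1 := Int.ceil_lt_add_one _
        have h3 : (k : ℝ) ≤ (L + r) / P + 1 := by linarith
        have := mul_le_mul_of_nonneg_right h3 hP0.le
        rwa [add_mul, div_mul_cancel₀ _ hP0.ne', one_mul] at this
      have hE_hi : E ≤ Real.exp (23 / 10) * y := by
        calc E ≤ Real.exp (L + (23 / 10)) := Real.exp_le_exp.2 (by linarith)
          _ = Real.exp (23 / 10) * y := by rw [Real.exp_add, hL, Real.exp_log hy0]; ring
      have hE_lo : y * Real.exp (-(53 / 10)) ≤ E := by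
        calc y * Real.exp (-(53 / 10)) = Real.exp (L + -(53 / 10)) := by
              rw [Real.exp_add, hL, Real.exp_log hy0]
          _ ≤ E := Real.exp_le_exp.2 (by linarith)
      -- the length `M k`
      obtain ⟨hexp_lo, hexp_hi⟩ := exp_sub_exp_neg_bounds hr0.le hr20
      have hMreal_hi : (M k : ℝ) ≤ 21 / 10 * r * E + 2 := by
        simp only [hM]
        have h1 : (⌈Real.exp (k * P + r)⌉₊ : ℝ) < Real.exp (k * P + r) + 1 := Nat.ceil_lt_add_one (Real.exp_pos _).le
        have h2 : Real.exp (k * P - r) - 1 < ⌊Real.exp (k * P - r)⌋₊ := by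
          have := Nat.lt_floor_add_one (Real.exp (k * P - r)); linarith
        have h3 : Real.exp (k * P + r) = E * Real.exp r := by rw [hE, ← Real.exp_add]
        have h4 : Real.exp (k * P - r) = E * Real.exp (-r) := by rw [hE, ← Real.exp_add]; ring_nf
        have hsub : ((⌈Real.exp (k * P + r)⌉₊ - ⌊Real.exp (k * P - r)⌋₊ : ℕ) : ℝ) ≤
            (⌈Real.exp (k * P + r)⌉₊ : ℝ) - ⌊Real.exp (k * P - r)⌋₊ := by
          rw [Nat.cast_sub]
          have h5 : (⌊Real.exp (k * P - r)⌋₊ : ℝ) ≤ Real.exp (k * P - r) := Nat.floor_le (Real.exp_pos _).le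
          have h6 : Real.exp (k * P - r) ≤ Real.exp (k * P + r) := Real.exp_le_exp.2 (by linarith)
          exact_mod_cast (h5.trans (h6.trans (Nat.le_ceil _)))
        have h7 : E * Real.exp r - E * Real.exp (-r) = E * (Real.exp r - Real.exp (-r)) := by ring
        have h8 := mul_le_mul_of_nonneg_left hexp_hi hE0.le
        nlinarith [h7, h8, h1, h2, h3, h4, hsub]
      have hMreal_lo : 19 / 10 * r * E ≤ (M k : ℝ) := by
        simp only [hM]
        have h1 : Real.exp (k * P + r) ≤ (⌈Real.exp (k * P + r)⌉₊ : ℝ) := Nat.le_ceil _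
        have h2 : (⌊Real.exp (k * P - r)⌋₊ : ℝ) ≤ Real.exp (k * P - r) := Nat.floor_le (Real.exp_pos _).le
        have h3 : Real.exp (k * P + r) = E * Real.exp r := by rw [hE, ← Real.exp_add]
        have h4 : Real.exp (k * P - r) = E * Real.exp (-r) := by rw [hE, ← Real.exp_add]; ring_nf
        have hle : ⌊Real.exp (k * P - r)⌋₊ ≤ ⌈Real.exp (k * P + r)⌉₊ := by
          have h6 : Real.exp (k * P - r) ≤ Real.exp (k * P + r) := Real.exp_le_exp.2 (by linarith)
          exact_mod_cast (h2.trans (h6.trans h1))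
        rw [Nat.cast_sub hle]
        have h7 : E * Real.exp r - E * Real.exp (-r) = E * (Real.exp r - Real.exp (-r)) := by ring
        have h8 := mul_le_mul_of_nonneg_left hexp_lo hE0.le
        nlinarith [h7, h8, h1, h2, h3, h4]
      -- `r E ≥ 12 e^{-5.3} √y · ...`: `M k ≥ 2` and `log (M k) ≥ 0.4 L`
      have hrE : (y : ℝ) ^ (1 / 2 : ℝ) * Real.exp (-(53 / 10)) * 12 ≤ r * E := by
        -- `r = ε'/t ≥ 12/√y` since `t ≤ ε' √y/12`
        have h1 : 12 * (y : ℝ) ^ (1 / 2 : ℝ) ≤ r * y := by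
          rw [hr, div_mul_eq_mul_div, le_div_iff₀ htpos]
          have h := mul_le_mul_of_nonneg_right htsqrt hsqrt0.le
          calc 12 * (y : ℝ) ^ (1 / 2 : ℝ) * t = t * 12 * (y : ℝ) ^ (1 / 2 : ℝ) := by ring
            _ ≤ ε' * (y : ℝ) ^ (1 / 2 : ℝ) * (y : ℝ) ^ (1 / 2 : ℝ) := h
            _ = ε' * y := by rw [mul_assoc, hsqrt_sq]
        have he0 : 0 ≤ Real.exp (-(53 / 10)) := (Real.exp_pos _).le
        calc (y : ℝ) ^ (1 / 2 : ℝ) * Real.exp (-(53 / 10)) * 12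
            = (12 * (y : ℝ) ^ (1 / 2 : ℝ)) * Real.exp (-(53 / 10)) := by ring
          _ ≤ (r * y) * Real.exp (-(53 / 10)) := mul_le_mul_of_nonneg_right h1 he0
          _ = r * (y * Real.exp (-(53 / 10))) := by ring
          _ ≤ r * E := mul_le_mul_of_nonneg_left hE_lo hr0.le
      have he53 : (1 / 250 : ℝ) ≤ Real.exp (-(53 / 10)) := by
        -- `e^{5.3} ≤ 250`? No: `e^{5.3} ≈ 200.3`; use `e^{5.3} ≤ 3^5.3 ≤ ...`; we prove `e^{53/10} ≤ 250`
        rw [Real.exp_neg, le_inv_comm₀ (by norm_num) (Real.exp_pos _)]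
        have h1 : Real.exp (53 / 10) ≤ Real.exp 1 ^ 6 / Real.exp (7 / 10) := by
          rw [le_div_iff₀ (Real.exp_pos _), ← Real.exp_add, Real.exp_one_pow]
          norm_num
        have h2 : Real.exp 1 ^ 6 ≤ (2.7182818286 : ℝ) ^ 6 :=
          pow_le_pow_left₀ (Real.exp_pos 1).le Real.exp_one_lt_d9.le 6
        have h3 : (1 : ℝ) + 7 / 10 ≤ Real.exp (7 / 10) := by
          have := Real.add_one_le_exp (7 / 10 : ℝ); linarith
        calc Real.exp (53 / 10) ≤ Real.exp 1 ^ 6 / Real.exp (7 / 10) := h1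
          _ ≤ (2.7182818286 : ℝ) ^ 6 / (1 + 7 / 10) := by
              exact div_le_div₀ (by positivity) h2 (by norm_num) h3
          _ ≤ (1 / 250)⁻¹ := by norm_num
      have hM_lo : (y : ℝ) ^ (1 / 2 : ℝ) / 12 ≤ (M k : ℝ) := by
        have h1 : (y : ℝ) ^ (1 / 2 : ℝ) * (1 / 250) * 12 ≤ (y : ℝ) ^ (1 / 2 : ℝ) * Real.exp (-(53 / 10)) * 12 :=
          mul_le_mul_of_nonneg_right (mul_le_mul_of_nonneg_left he53 hsqrt0.le) (by norm_num)
        have h2 : (y : ℝ) ^ (1 / 2 : ℝ) / 12 ≤ 19 / 10 * ((y : ℝ) ^ (1 / 2 : ℝ) * (1 / 250) * 12) := by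
          rw [div_le_iff₀ (by norm_num : (0 : ℝ) < 12)]
          nlinarith [hsqrt0]
        linarith
      have hM2 : 2 ≤ M k := by
        have : (2 : ℝ) ≤ M k := by
          have : (24 : ℝ) ≤ (y : ℝ) ^ (1 / 2 : ℝ) := by linarith [hsqrtC, hC]
          linarith
        exact_mod_cast this
      have hM0 : (0 : ℝ) < M k := by exact_mod_cast (lt_of_lt_of_le zero_lt_two hM2)
      have hlogM : 2 / 5 * L ≤ Real.log (M k) := by
        have h1 : Real.log ((y : ℝ) ^ (1 / 2 : ℝ) / 12) ≤ Real.log (M k) :=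
          Real.log_le_log (by positivity) hM_lo
        rw [Real.log_div hsqrt0.ne' (by norm_num), Real.log_rpow hy0] at h1
        have hl12 : Real.log 12 ≤ 3 := by
          rw [Real.log_le_iff_le_exp (by norm_num)]
          linarith [exp_three_gt]
        rw [hL] at hL30 ⊢
        linarith
      have hlogNM : Real.log (((N k + M k : ℕ)) : ℝ) ≤ L + 3 := by
        have hNM : ((N k + M k : ℕ) : ℝ) ≤ Real.exp (k * P + r) + 1 := by
          have hNM' : N k + M k = ⌈Real.exp (k * P + r)⌉₊ := by
            simp only [hN, hM]
            have : ⌊Real.exp (k * P - r)⌋₊ ≤ ⌈Real.exp (k * P + r)⌉₊ := by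
              have h5 : (⌊Real.exp (k * P - r)⌋₊ : ℝ) ≤ Real.exp (k * P - r) := Nat.floor_le (Real.exp_pos _).le
              have h6 : Real.exp (k * P - r) ≤ Real.exp (k * P + r) := Real.exp_le_exp.2 (by linarith)
              exact_mod_cast (h5.trans (h6.trans (Nat.le_ceil _)))
            omega
          rw [hNM']
          exact (Nat.ceil_lt_add_one (Real.exp_pos _).le).le
        have hpos : (0 : ℝ) < ((N k + M k : ℕ) : ℝ) := by
          have h0 : (0 : ℝ) < (M k : ℝ) := hM0
          have hN0 : (0 : ℝ) ≤ (N k : ℝ) := Nat.cast_nonneg _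
          push_cast; linarith
        calc Real.log (((N k + M k : ℕ)) : ℝ) ≤ Real.log (Real.exp (k * P + r) + 1) :=
              Real.log_le_log hpos hNM
          _ ≤ Real.log (Real.exp (L + 3)) := by
              refine Real.log_le_log (by positivity) ?_
              have h1 : Real.exp (k * P + r) ≤ Real.exp (L + 2.3) := Real.exp_le_exp.2 (by linarith)
              have h2 : Real.exp (L + 2.3) + 1 ≤ Real.exp (L + 3) := by
                have h3 : Real.exp (L + 3) = Real.exp (L + 2.3) * Real.exp 0.7 := by
                  rw [← Real.exp_add]; ring_nf
                have h4 : (1 : ℝ) + 0.7 ≤ Real.exp 0.7 := by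
                  have := Real.add_one_le_exp (0.7 : ℝ); linarith
                have h5 : (33 : ℝ) ≤ Real.exp (L + 2.3) := by
                  have := Real.add_one_le_exp (L + 2.3); linarith
                have h6 := mul_le_mul_of_nonneg_left h4 (Real.exp_pos (L + 2.3)).le
                rw [h3]
                linarith
              linarith
          _ = L + 3 := Real.log_exp _
      -- Brun–Titchmarsh
      have hbt := hBT (N k) (M k) hM2
      calc ∑ p ∈ S k, Real.log p ≤ C * (M k) * Real.log (((N k + M k : ℕ)) : ℝ) / Real.log (M k) := hbt
        _ ≤ C * (M k) * (L + 3) / (2 / 5 * L) := by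
            have hnum : C * (M k) * Real.log (((N k + M k : ℕ)) : ℝ) ≤ C * (M k) * (L + 3) :=
              mul_le_mul_of_nonneg_left hlogNM (by positivity)
            have hden : 0 < 2 / 5 * L := by positivity
            calc C * (M k) * Real.log (((N k + M k : ℕ)) : ℝ) / Real.log (M k)
                ≤ C * (M k) * (L + 3) / Real.log (M k) :=
                  div_le_div_of_nonneg_right hnum (by linarith)
              _ ≤ C * (M k) * (L + 3) / (2 / 5 * L) :=
                  div_le_div_of_nonneg_left (by positivity) hden hlogM
        _ ≤ C * (M k) * 3 := by
            -- `(L + 3)/(0.4 L) ≤ 3` for `L ≥ 30`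
            rw [div_le_iff₀ (by positivity)]
            have : C * (M k) * (L + 3) ≤ C * (M k) * (3 * (2 / 5 * L)) :=
              mul_le_mul_of_nonneg_left (by linarith) (by positivity)
            linarith
        _ ≤ C * (21 / 10 * r * E + 2) * 3 := by
            refine mul_le_mul_of_nonneg_right (mul_le_mul_of_nonneg_left hMreal_hi hC.le) (by norm_num)
        _ ≤ 76 * C * ε' * y / t + 6 * C := by
            -- `3 · (21/10) r E ≤ 6.3 (ε'/t) · e^{2.3} y` and `e^{2.3} ≤ 12`
            have he23 : Real.exp (23 / 10) ≤ 12 := by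
              have h1 : Real.exp (23 / 10) ≤ Real.exp 1 ^ 3 / Real.exp (7 / 10) := by
                rw [le_div_iff₀ (Real.exp_pos _), ← Real.exp_add, Real.exp_one_pow]
                norm_num
              have h2 : Real.exp 1 ^ 3 ≤ (2.7182818286 : ℝ) ^ 3 :=
                pow_le_pow_left₀ (Real.exp_pos 1).le Real.exp_one_lt_d9.le 3
              have h3 : (1 : ℝ) + 7 / 10 ≤ Real.exp (7 / 10) := by
                have := Real.add_one_le_exp (7 / 10 : ℝ); linarith
              calc Real.exp (23 / 10) ≤ Real.exp 1 ^ 3 / Real.exp (7 / 10) := h1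
                _ ≤ (2.7182818286 : ℝ) ^ 3 / (1 + 7 / 10) :=
                    div_le_div₀ (by positivity) h2 (by norm_num) h3
                _ ≤ 12 := by norm_num
            have hrE_hi : r * E ≤ ε' / t * (12 * y) := by
              rw [hr]
              exact mul_le_mul_of_nonneg_left
                (le_trans hE_hi (mul_le_mul_of_nonneg_right he23 hy0.le)) (by positivity)
            have : C * (21 / 10 * r * E + 2) * 3 = 63 / 10 * C * (r * E) + 6 * C := by ring
            rw [this]
            have h2 : 63 / 10 * C * (r * E) ≤ 63 / 10 * C * (ε' / t * (12 * y)) :=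
              mul_le_mul_of_nonneg_left hrE_hi (by positivity)
            have h3 : 63 / 10 * C * (ε' / t * (12 * y)) ≤ 76 * C * ε' * y / t := by
              rw [show 63 / 10 * C * (ε' / t * (12 * y)) = (756 / 10) * C * ε' * y / t by ring]
              refine div_le_div_of_nonneg_right ?_ htpos.le
              nlinarith [mul_pos hC hε'0, hy0]
            linarith
    -- (3) the number of `k`
    have hcardK : (Kset.card : ℝ) ≤ 3 / 2 * t := by
      rw [hKset, Int.card_Icc]
      have hdiff : ((khi + 1 - klo).toNat : ℝ) ≤ (L + r) / P + 2 - ((L - 3 - r) / P - 1) := by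
        have h1 : ((⌈(L + r) / P⌉ : ℤ) : ℝ) < (L + r) / P + 1 := Int.ceil_lt_add_one _
        have h2 : (L - 3 - r) / P - 1 < ((⌊(L - 3 - r) / P⌋ : ℤ) : ℝ) := by
          have := Int.lt_floor_add_one ((L - 3 - r) / P); linarith
        rcases le_or_gt 0 (khi + 1 - klo) with hnn | hneg
        · have : (((khi + 1 - klo).toNat : ℤ) : ℝ) = ((khi + 1 - klo : ℤ) : ℝ) := by
            rw [Int.toNat_of_nonneg hnn]
          have hcast : ((khi + 1 - klo).toNat : ℝ) = (khi : ℝ) + 1 - klo := by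
            rw [show ((khi + 1 - klo).toNat : ℝ) = (((khi + 1 - klo).toNat : ℤ) : ℝ) by norm_cast,
              this]
            push_cast; ring
          rw [hcast, hkhi, hklo]
          linarith
        · rw [Int.toNat_eq_zero.2 hneg.le]
          simp only [Nat.cast_zero]
          have : 0 ≤ (3 + 2 * r) / P := by positivity
          have heq : (L + r) / P + 2 - ((L - 3 - r) / P - 1) = (3 + 2 * r) / P + 3 := by
            field_simp; ring
          linarith
      have heq : (L + r) / P + 2 - ((L - 3 - r) / P - 1) = (3 + 2 * r) / P + 3 := by
        field_simp; ring
      rw [heq] at hdiff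
      -- `(3 + 2r)/P = (3 + 2r) t/(2π) ≤ 0.5 t`, and `3 ≤ t`
      have h1 : (3 + 2 * r) / P ≤ t / 2 := by
        rw [hP, div_div_eq_mul_div, div_le_div_iff₀ (by positivity) (by norm_num)]
        have h2 : (3 + 2 * r) * 2 ≤ 2 * Real.pi := by linarith
        have h3 := mul_le_mul_of_nonneg_left h2 htpos.le
        nlinarith [h3]
      linarith
    -- (4) assemble the bad mass
    calc ∑ p ∈ Bad, Real.log p ≤ ∑ p ∈ Kset.biUnion S, Real.log p :=
          Finset.sum_le_sum_of_subset_of_nonneg hcover fun p hp _ => by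
            obtain ⟨k, -, hk⟩ := Finset.mem_biUnion.1 hp
            have hpp := (Finset.mem_filter.1 hk).2
            exact Real.log_nonneg (by exact_mod_cast hpp.one_lt.le)
      _ ≤ ∑ k ∈ Kset, ∑ p ∈ S k, Real.log p := by
          refine sum_biUnion_le_sum' Kset S fun p => ?_
          rcases Nat.eq_zero_or_pos p with rfl | hp
          · simp
          · exact Real.log_nonneg (by exact_mod_cast hp)
      _ ≤ ∑ k ∈ Kset, (76 * C * ε' * y / t + 6 * C) := Finset.sum_le_sum hper
      _ = Kset.card * (76 * C * ε' * y / t + 6 * C) := by rw [Finset.sum_const, nsmul_eq_mul]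
      _ ≤ 3 / 2 * t * (76 * C * ε' * y / t + 6 * C) :=
          mul_le_mul_of_nonneg_right hcardK (by positivity)
      _ = 114 * (C * ε') * y + 9 * C * t := by field_simp; ring
      _ ≤ (y : ℝ) / 10 := by
          -- `114 C ε' ≤ 0.057` and `9 C t ≤ 9 C κ √y = (3/4) C ε' √y ≤ √y/1000 ≤ 0.001 y`
          have h1 : 114 * (C * ε') * y ≤ 114 / 2000 * y :=
            mul_le_mul_of_nonneg_right (by linarith) hy0.le
          have h2 : 9 * C * t ≤ (y : ℝ) ^ (1 / 2 : ℝ) / 1000 := by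
            have : 9 * C * t ≤ 9 * C * (ε' / 12 * (y : ℝ) ^ (1 / 2 : ℝ)) := by
              rw [← hκ]; exact mul_le_mul_of_nonneg_left htκ (by positivity)
            have h3 : 9 * C * (ε' / 12 * (y : ℝ) ^ (1 / 2 : ℝ)) = 3 / 4 * (C * ε') * (y : ℝ) ^ (1 / 2 : ℝ) := by
              ring
            rw [h3] at this
            have h4 : 3 / 4 * (C * ε') * (y : ℝ) ^ (1 / 2 : ℝ) ≤ 3 / 4 * (1 / 2000) * (y : ℝ) ^ (1 / 2 : ℝ) :=
              mul_le_mul_of_nonneg_right (mul_le_mul_of_nonneg_left hCε' (by norm_num)) hsqrt0.le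
            linarith
          have h3 : (y : ℝ) ^ (1 / 2 : ℝ) ≤ y := by
            calc (y : ℝ) ^ (1 / 2 : ℝ) = (y : ℝ) ^ (1 / 2 : ℝ) * 1 := (mul_one _).symm
              _ ≤ (y : ℝ) ^ (1 / 2 : ℝ) * (y : ℝ) ^ (1 / 2 : ℝ) := by
                  refine mul_le_mul_of_nonneg_left ?_ hsqrt0.le
                  linarith [hsqrtC, hC]
              _ = y := hsqrt_sq
          linarith
  -- ### the good primes
  have hgood_mass : 17 / 100 * (y : ℝ) ≤ ∑ p ∈ Good, Real.log p := by linarith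
  have hterm : ∀ p ∈ Good, δ * (y : ℝ) ^ (-σ) / L * Real.log p ≤
      (p : ℝ) ^ (-σ) * (1 - Real.cos (t * Real.log p)) := by
    intro p hp
    rw [hGood, Finset.mem_filter] at hp
    obtain ⟨hpQ, hnot⟩ := hp
    obtain ⟨hpp, hpa, hpy⟩ := hmemQ p hpQ
    have hp0 : (0 : ℝ) < p := by exact_mod_cast hpp.pos
    push Not at hnot
    have hcos : Real.cos (t * Real.log p) ≤ Real.cos ε' := cos_le_cos_of_forall_dist hε'0.le hnot
    have hone : δ ≤ 1 - Real.cos (t * Real.log p) := by rw [hδ]; linarith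
    have hpow : (y : ℝ) ^ (-σ) ≤ (p : ℝ) ^ (-σ) := Real.rpow_le_rpow_of_nonpos hp0 hpy (by linarith)
    have hlogp : Real.log p ≤ L := Real.log_le_log hp0 hpy
    have hlogp0 : 0 ≤ Real.log p := Real.log_nonneg (by exact_mod_cast hpp.one_lt.le)
    have hyσ : 0 < (y : ℝ) ^ (-σ) := Real.rpow_pos_of_pos hy0 _
    calc δ * (y : ℝ) ^ (-σ) / L * Real.log p = (δ * (y : ℝ) ^ (-σ)) * (Real.log p / L) := by
          field_simp
      _ ≤ (δ * (y : ℝ) ^ (-σ)) * 1 := by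
          refine mul_le_mul_of_nonneg_left ?_ (by positivity)
          rwa [div_le_one hL0]
      _ = (y : ℝ) ^ (-σ) * δ := by ring
      _ ≤ (p : ℝ) ^ (-σ) * (1 - Real.cos (t * Real.log p)) :=
          mul_le_mul hpow hone hδ0.le (Real.rpow_nonneg hp0.le _)
  have hGoodsub : Good ⊆ Nat.primesLE y := (Finset.filter_subset _ _).trans hQsub
  have hnonneg : ∀ p ∈ Nat.primesLE y, 0 ≤ (p : ℝ) ^ (-σ) * (1 - Real.cos (t * Real.log p)) := by
    intro p _
    have hp0 : (0 : ℝ) ≤ p := Nat.cast_nonneg _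
    exact mul_nonneg (Real.rpow_nonneg hp0 _) (by linarith [Real.cos_le_one (t * Real.log p)])
  have hyσ : 0 < (y : ℝ) ^ (-σ) := Real.rpow_pos_of_pos hy0 _
  calc 17 / 100 * δ * ((y : ℝ) ^ (1 - σ) / Real.log y)
      = δ * (y : ℝ) ^ (-σ) / L * (17 / 100 * y) := by
        rw [show (1 : ℝ) - σ = -σ + 1 by ring, Real.rpow_add hy0, Real.rpow_one, ← hL]
        field_simp
    _ ≤ δ * (y : ℝ) ^ (-σ) / L * ∑ p ∈ Good, Real.log p :=
        mul_le_mul_of_nonneg_left hgood_mass (by positivity)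
    _ = ∑ p ∈ Good, δ * (y : ℝ) ^ (-σ) / L * Real.log p := by rw [Finset.mul_sum]
    _ ≤ ∑ p ∈ Good, (p : ℝ) ^ (-σ) * (1 - Real.cos (t * Real.log p)) := Finset.sum_le_sum hterm
    _ ≤ ∑ p ∈ Nat.primesLE y, (p : ℝ) ^ (-σ) * (1 - Real.cos (t * Real.log p)) :=
        Finset.sum_le_sum_of_subset_of_nonneg hGoodsub fun p hp _ => hnonneg p hp

end Literature.NumberTheory.Sieve

end
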